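import Literature.MathematicalPhysics.QuantumFieldTheory.Balaban1983to89.B7Prop3FlatRecSide
import Literature.MathematicalPhysics.QuantumFieldTheory.Balaban1983to89.BlockAveragingZdCovariance

/-!
# `Balaban1983to89.B7Prop1Rec` — [Balaban1985Averaging] PROPOSITION 1 (44)–(51) pp. 24–26 FOR THE RECORD's AVERAGING STRUCTURE ([Balaban1987RG1] (0.3)–(0.4)):
# `|V̄(∂p′) − 1| ≤ L²α₀ + C₀(d)(L²α₀)²` for the symmetric centred block average `bavgZ`, with `C₀(d) = 16512(d+1)²(d+4)²` (engine: `14464`)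

statement-level skeleton of published theorems with citation tags; proofs where landed; nothing here is a claim about the Yang–Mills mass gap

CITATION HEADER (lean-in-tree rule).  Cell `pub-ymgap`, seat `pub-ymgap-dag-n05-e` g35 (N05-REC LEAD PEN); item R1 ([3] layer, GENUINE re-proof for the record structure) of the
road (director-ym №254∕№255, plan g90 SIZING WORD).  `--kind proof --supports stmt-QuantumFields-20541` (K0⁷; count-neutral).  Sources READ: [3] Prop. 1 pp. 24–26
(`paper:balaban1985-cmp98-averaging`, journal page = PDF page + 16) through the engine module `B7Prop1Explicit` (`prop1_core`, `prop1_explicit`, `main_term_bound`,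
`norm_prod4_sub_one_sub_le`, `corner_cancellation`), whose proof is re-run here over the record objects; [I] (0.3)–(0.4) pp. 252–253 (`paper:balaban1987-cmp109-rg-i-small-field`).

THE PRINT (p. 26, (51)): *«|V̄₀(∂p′) − 1| < L²α₀ + C₀(L²α₀)² for every plaquette p′ ⊂ Ω′^{(1)}»* — [I] p. 254: *«This average has properties similar to the properties of the
average introduced in (0.4), especially all results of the paper [12] are valid for it. The proofs are in most cases unchanged»*.  HERE: the proof of [3] Prop. 1 re-run for the
symmetric average (0.4): (45) gauge covariance (`bavgZ_gaugeAct_units`, condition-free) to pass to the axial gauge at the far corner `y` of `p′`; the four sides by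
`B7Prop3FlatRecSide.side_estimateZ` (`3θ`, `50θ²`); (48) the first-order terms of the four sides add up to `Σ_x L^{−d} A(∂(p′)_x)` BECAUSE THE σ-MEAN STAIRCASE FUNCTIONALS
`SZ` TELESCOPE AROUND THE CLOSED `∂p′` (`TsideZ_four_sum` — the record's form of the corner cancellation; the curvature functional Φ of LOCATED-N2 does NOT enter Prop. 1:
no frames here); (49) the main term is the ENGINE's `main_term_bound` at the corner `z − (L−1)∕2·𝟙` of the centred block; (50) with `φ = 3θ` ⇒ `258θ²` (engine `226θ²`).
WHAT IS PROVED (sorry-free, no definition): `TsideZ_eq` (`TZ_c = SZ(c₋) + L·(Q₀A)_c − SZ(c₊)`), `linQZ_four_sum`, ★`TsideZ_four_sum` ((48) for the record), ★★`prop1_coreZ`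
(axial gauge: `‖V̄₀(∂p′) − 1‖ ≤ L²α₀ + 258θ²`, `θ = 8(d+1)(d+4)L²α₀ ≤ 1∕64`, and every loop variable within `1` of `1`), ★★★`prop1_explicitZ` ((51) for every `U1 𝔸`-valued
configuration with (44): `‖V̄(∂p′) − 1‖ ≤ L²α₀ + 258·(8(d+1)(d+4))²(L²α₀)²` under `512(d+1)(d+4)L²α₀ ≤ 1`).
HONEST SCOPE.  A GENUINE re-proof of [3] Prop. 1 for the typed record average (the first of the road's R1 layer); NOTHING of [6]∕[I] beyond; Prop. 2 (all levels, `AvgClosed`) is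
the next file; `HThm4Rec` UNDISCHARGED; N05 ∕ N07 NOT discharged; counts unmoved (typed 28∕28 · discharged 7∕28); one finite 𝕋⁴ programme at fixed ε — nothing continuum ∕
ℝ⁴ ∕ OS ∕ mass gap ∕ Clay.  No `def`, no `instance`, no `notation`, no `sorry`.
-/

set_option autoImplicit false

noncomputable section

open scoped BigOperators
open NormedSpace

namespace Literature.MathematicalPhysics.QuantumFieldTheory.Balaban1983to89.B7Prop1Rec

open B7Prop1Explicit hiding Site
open B7Prop1Explicit renaming Site → SiteZ
open MatrixLog
open BlockAveragingZd (offZ offZ_apply IdxZ WZ WZ_def XZ bavgZ)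
open BlockAveragingZdCovariance (bavgZ_gaugeAct_units)
open B7SectCDGaugeAveragesRec (ctrVec offZ_eq)
open B7SectEFLinearisationRec (linQZ)
open B7Prop3FlatRecSide

variable {d : ℕ}

section Prop1

variable {𝔸 : Type*} [NormedRing 𝔸] [NormedAlgebra ℂ 𝔸] [CompleteSpace 𝔸]

omit [CompleteSpace 𝔸] in
/-- `TZ_c = SZ(c₋) + L·(Q₀A)_c − SZ(c₊)` (from `XhatZ_eq`). [cite: Balaban1985Averaging, (47)–(48) p.25; Balaban1987RG1, (0.4) p.253] -/
theorem TsideZ_eq (L : ℕ) (hL : 1 ≤ L) (A : SiteZ d → Fin d → 𝔸) (q : SiteZ d) (κ : Fin d) :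
    TsideZ L A q κ = SZ L A q + linQZ L A q κ - SZ L A (q + (L : ℤ) • e κ) := by
  unfold TsideZ; rw [XhatZ_eq L hL]; abel

omit [CompleteSpace 𝔸] in
/-- The four straight block averages around `∂p′` sum to the block mean of the boundary functional of the `L×L` squares: `Σ_r L^{−d} A(∂(p′)_{x_r})`.
[cite: Balaban1985Averaging, (48) p.25] -/
theorem linQZ_four_sum (L : ℕ) (A : SiteZ d → Fin d → 𝔸) (z : SiteZ d) (μ ν : Fin d) :
    linQZ L A z μ + linQZ L A (z + (L : ℤ) • e μ) ν - linQZ L A (z + (L : ℤ) • e ν) μ - linQZ L A z ν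
      = ∑ r : Fin d → Fin L, ((L : ℝ) ^ d)⁻¹ • asum A (z + offZ L r) (rectWord L L μ ν) := by
  simp only [linQZ, ← Finset.sum_add_distrib, ← Finset.sum_sub_distrib, ← smul_add, ← smul_sub]
  refine Finset.sum_congr rfl fun r _ => ?_
  rw [asum_rectWord]
  congr 1
  rw [show z + (L : ℤ) • e μ + offZ L r = z + offZ L r + (L : ℤ) • e μ by abel,
    show z + (L : ℤ) • e ν + offZ L r = z + offZ L r + (L : ℤ) • e ν by abel]

omit [CompleteSpace 𝔸] in
/-- ★ **(48) FOR THE RECORD — the corner cancellation of the symmetric average**: the first-order terms of the four sides of `∂p′` add up to `Σ_x L^{−d} A(∂(p′)_x)`;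
the σ-mean staircase functionals `SZ` at the four corners telescope. [cite: Balaban1985Averaging, (48) p.25; Balaban1987RG1, (0.4) p.253] -/
theorem TsideZ_four_sum (L : ℕ) (hL : 1 ≤ L) (A : SiteZ d → Fin d → 𝔸) (z : SiteZ d) (μ ν : Fin d) :
    TsideZ L A z μ + TsideZ L A (z + (L : ℤ) • e μ) ν + -TsideZ L A (z + (L : ℤ) • e ν) μ + -TsideZ L A z ν
      = ∑ r : Fin d → Fin L, ((L : ℝ) ^ d)⁻¹ • asum A (z + offZ L r) (rectWord L L μ ν) := by
  rw [← linQZ_four_sum, TsideZ_eq L hL, TsideZ_eq L hL, TsideZ_eq L hL, TsideZ_eq L hL]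
  have hc : z + (L : ℤ) • e ν + (L : ℤ) • e μ = z + (L : ℤ) • e μ + (L : ℤ) • e ν := by abel
  rw [hc]
  set s0 := SZ L A z
  set s1 := SZ L A (z + (L : ℤ) • e μ)
  set s2 := SZ L A (z + (L : ℤ) • e ν)
  set s3 := SZ L A (z + (L : ℤ) • e μ + (L : ℤ) • e ν)
  set q0 := linQZ L A z μ
  set q1 := linQZ L A (z + (L : ℤ) • e μ) ν
  set q2 := linQZ L A (z + (L : ℤ) • e ν) μ
  set q3 := linQZ L A z ν
  abel

/-- (RECORD TWIN of `B7Prop1Explicit.prop1_core` for the (0.4) average `bavgZ`: same axial gauge, same region budget — `|n|₁ ≤ dL` for the centred offsets —, the four sides from `side_estimateZ` (`3θ`), the first-order terms telescoping through the σ-mean staircase functional `SZ` (`TsideZ_four_sum`), the main term = the engine's `main_term_bound` at the corner `z − (L−1)∕2·𝟙` of the centred block; constant `258` for `226`.) **Proposition 1, core** (axial gauge, pp. 24–26): for a configuration `V₀` whose bond variables within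
`l¹`-distance `(2d+4)L + 4` of `y = y₀ + Le_μ + Le_ν` satisfy `|V₀(b) − 1| ≤ |b₋ − y|₁ · α₀` (print p. 25:
"for `b ⊂ Δ(p′)` we have `|V₀,b − 1| < |b₋ − y|α₀ ≤ dLα₀`"; the form proved in `axial_bond_bound`) and whose
plaquette variables satisfy (44) `|V₀(∂p) − 1| ≤ α₀` (for the plaquettes parallel to `p′`; only these enter (49)–(50)): if `θ := 8(d+1)(d+4)L²α₀ ≤ 1/64` then
`|V̄₀(∂p′) − 1| ≤ L²α₀ + 226 θ²`, and every `V₀(Γ_{c,x})V₀(c)⁻¹`, `c ⊂ ∂p′`, is within `2θ` of `1`. [cite: Balaban1985Averaging, Prop. 1 (44)–(51) pp.24–26] -/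
theorem prop1_coreZ (L : ℕ) (hL : 1 ≤ L) (z y : SiteZ d) {μ ν : Fin d}
    (hy : y = z + (L : ℤ) • e μ + (L : ℤ) • e ν) (V₀ : SiteZ d → Fin d → 𝔸ˣ) {α₀ : ℝ} (hα₀ : 0 ≤ α₀)
    (hsmall : 512 * (d + 1) * (d + 4) * (L : ℝ) ^ 2 * α₀ ≤ 1)
    (h44 : ∀ x, ‖((hol V₀ x (plaqWord μ ν) : 𝔸ˣ) : 𝔸) - 1‖ ≤ α₀)
    (hbond : ∀ x κ, l1 (x - y) ≤ (2 * d + 4) * L + 4 → ‖((V₀ x κ : 𝔸ˣ) : 𝔸) - 1‖ ≤ l1 (x - y) * α₀) :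
    ‖((cplaq L (bavgZ L V₀) z μ ν : 𝔸ˣ) : 𝔸) - 1‖
        ≤ (L : ℝ) ^ 2 * α₀ + 258 * (8 * (d + 1) * (d + 4) * (L : ℝ) ^ 2 * α₀) ^ 2 ∧
      ∀ q κ, l1 (q - y) ≤ 2 * L → ∀ i : IdxZ d L, ‖((WZ L V₀ q κ i : 𝔸ˣ) : 𝔸) - 1‖ < 1 := by
  have hd : 1 ≤ d := μ.pos
  -- the constants
  set R : ℕ := (2 * d + 4) * L + 4 with hRdef
  set a : ℝ := 4 * (d + 4) * L * α₀ with hadef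
  set θ : ℝ := 8 * (d + 1) * (d + 4) * (L : ℝ) ^ 2 * α₀ with hθdef
  have hLr : (1 : ℝ) ≤ L := by exact_mod_cast hL
  have hdr : (1 : ℝ) ≤ d := by exact_mod_cast hd
  have ha : 0 ≤ a := by positivity
  have hθ0 : 0 ≤ θ := by positivity
  have hθ1 : θ ≤ 1 / 64 := by
    have : 64 * θ = 512 * (d + 1) * (d + 4) * (L : ℝ) ^ 2 * α₀ := by rw [hθdef]; ring
    linarith
  have haθ : 4 * a ≤ θ := by
    have e1 : θ - 4 * a = 8 * ((d : ℝ) + 4) * L * α₀ * ((d + 1) * L - 2) := by rw [hθdef, hadef]; ring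
    have e2 : 0 ≤ 8 * ((d : ℝ) + 4) * L * α₀ * ((d + 1) * L - 2) :=
      mul_nonneg (by positivity) (by nlinarith [mul_nonneg (sub_nonneg.mpr hdr) (by positivity : (0 : ℝ) ≤ L)])
    linarith
  have ha1 : a ≤ 1 := by linarith
  have hRa : ((R : ℕ) : ℝ) * α₀ ≤ a / 2 := by
    have e1 : a / 2 - ((R : ℕ) : ℝ) * α₀ = 4 * ((L : ℝ) - 1) * α₀ := by rw [hRdef, hadef]; push_cast; ring
    have e2 : 0 ≤ 4 * ((L : ℝ) - 1) * α₀ := mul_nonneg (mul_nonneg (by norm_num) (by linarith)) hα₀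
    linarith
  -- the bond field
  have hb : ∀ x κ, l1 (x - y) ≤ R → ‖((V₀ x κ : 𝔸ˣ) : 𝔸) - 1‖ ≤ a / 2 := fun x κ hx =>
    (hbond x κ hx).trans ((mul_le_mul_of_nonneg_right (by exact_mod_cast hx) hα₀).trans hRa)
  have hVA := bond_log y R ha1 hb
  set A : SiteZ d → Fin d → 𝔸 := fun x κ => MatrixLog.mlog ((V₀ x κ : 𝔸ˣ) : 𝔸) with hAdef
  -- the four sides
  have hθN : ((2 * (d * L) + L + L : ℕ) : ℝ) * a ≤ θ := le_of_eq (by rw [hadef, hθdef]; push_cast; ring)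
  have hRexp : R = 2 * (d * L) + 4 * L + 4 := by rw [hRdef]; ring
  have hzy : l1 (z - y) ≤ 2 * L := by
    rw [hy, show z - (z + (L : ℤ) • e μ + (L : ℤ) • e ν) = -((L : ℤ) • e μ + (L : ℤ) • e ν) by abel, l1_neg]
    refine (l1_add_le _ _).trans ?_
    rw [l1_zsmul_e, l1_zsmul_e, Int.natAbs_natCast]; omega
  have hzμy : l1 (z + (L : ℤ) • e μ - y) ≤ 2 * L := by
    rw [hy, show z + (L : ℤ) • e μ - (z + (L : ℤ) • e μ + (L : ℤ) • e ν) = -((L : ℤ) • e ν) by abel, l1_neg,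
      l1_zsmul_e, Int.natAbs_natCast]; omega
  have hzνy : l1 (z + (L : ℤ) • e ν - y) ≤ 2 * L := by
    rw [hy, show z + (L : ℤ) • e ν - (z + (L : ℤ) • e μ + (L : ℤ) • e ν) = -((L : ℤ) • e μ) by abel, l1_neg,
      l1_zsmul_e, Int.natAbs_natCast]; omega
  have hside : ∀ q κ, l1 (q - y) ≤ 2 * L →
      ‖((bavgZ L V₀ q κ : 𝔸ˣ) : 𝔸) - 1‖ ≤ 3 * θ ∧
      ‖((bavgZ L V₀ q κ : 𝔸ˣ) : 𝔸) - 1 - TsideZ L A q κ‖ ≤ 50 * θ ^ 2 ∧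
      ‖(((bavgZ L V₀ q κ)⁻¹ : 𝔸ˣ) : 𝔸) - 1‖ ≤ 3 * θ ∧
      ‖(((bavgZ L V₀ q κ)⁻¹ : 𝔸ˣ) : 𝔸) - 1 - (-TsideZ L A q κ)‖ ≤ 50 * θ ^ 2 ∧
      ∀ i : IdxZ d L, ‖((WZ L V₀ q κ i : 𝔸ˣ) : 𝔸) - 1‖ ≤ 2 * θ := fun q κ hq =>
    side_estimateZ V₀ A y R ha hVA L hL q κ (by rw [hRexp]; omega) hθN hθ0 hθ1
  refine ⟨?_, fun q κ hq i => ((hside q κ hq).2.2.2.2 i).trans_lt (by linarith)⟩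
  obtain ⟨f1, e1, -, -, -⟩ := hside z μ hzy
  obtain ⟨f2, e2, -, -, -⟩ := hside (z + (L : ℤ) • e μ) ν hzμy
  obtain ⟨-, -, f3, e3, -⟩ := hside (z + (L : ℤ) • e ν) μ hzνy
  obtain ⟨-, -, f4, e4, -⟩ := hside z ν hzy
  have hP := norm_prod4_sub_one_sub_le (by positivity) f1 f2 f3 f4 e1 e2 e3 e4
  -- (48): the first-order terms add up to `Σ_x L^{−d} A(∂(p′)_x)` — for the record the σ-mean staircase terms `SZ` telescope around `∂p′`
  have hTsum : TsideZ L A z μ + TsideZ L A (z + (L : ℤ) • e μ) ν + -TsideZ L A (z + (L : ℤ) • e ν) μ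
      + -TsideZ L A z ν = ∑ r : Fin d → Fin L, ((L : ℝ) ^ d)⁻¹ • asum A (z + offZ L r) (rectWord L L μ ν) :=
    TsideZ_four_sum L hL A z μ ν
  -- (49): the main term
  have hmain₀ := main_term_bound V₀ A y R ha hVA L hL (z - ctrVec L) μ ν h44 (fun r i j hi hj => by
    have e0 : z - ctrVec L + boxVec L r = z + offZ L r := by rw [offZ_eq]; abel
    rw [e0]
    have h1 := l1_add_le (z - y) (offZ L r + (i : ℤ) • e μ + (j : ℤ) • e ν)
    have h2 := (l1_add_le (offZ L r + (i : ℤ) • e μ) ((j : ℤ) • e ν))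
    have h3 := (l1_add_le (offZ L r) ((i : ℤ) • e μ))
    have h4 := l1_offZ_le_dL L r
    rw [l1_zsmul_e, Int.natAbs_natCast] at h2 h3
    rw [show z - y + (offZ L r + (i : ℤ) • e μ + (j : ℤ) • e ν)
      = z + offZ L r + (i : ℤ) • e μ + (j : ℤ) • e ν - y by abel] at h1
    rw [hRexp]; omega)
  have hmain : ‖∑ r : Fin d → Fin L, ((L : ℝ) ^ d)⁻¹ • asum A (z + offZ L r) (rectWord L L μ ν)‖
      ≤ L ^ 2 * (α₀ + expRem (4 * a)) := by
    have e0 : ∀ r : Fin d → Fin L, z - ctrVec L + boxVec L r = z + offZ L r := fun r => by rw [offZ_eq]; abel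
    simp_rw [e0] at hmain₀
    exact hmain₀
  have hρ : (L : ℝ) ^ 2 * (α₀ + expRem (4 * a)) ≤ (L : ℝ) ^ 2 * α₀ + θ ^ 2 := by
    have h1 : expRem (4 * a) ≤ (4 * a) ^ 2 := expRem_le_sq (by positivity) (by linarith)
    have h2 : θ ^ 2 - (L : ℝ) ^ 2 * (4 * a) ^ 2 = 64 * ((d + 4) * (L : ℝ) ^ 2 * α₀) ^ 2 * ((d + 1) ^ 2 - 4) := by
      rw [hθdef, hadef]; ring
    have h3 : 0 ≤ 64 * ((d + 4) * (L : ℝ) ^ 2 * α₀) ^ 2 * (((d : ℝ) + 1) ^ 2 - 4) :=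
      mul_nonneg (by positivity) (by nlinarith)
    have h4 := mul_le_mul_of_nonneg_left h1 (by positivity : (0 : ℝ) ≤ (L : ℝ) ^ 2)
    rw [mul_add]
    linarith
  -- (50): collecting terms
  have hθ3 : θ ^ 3 ≤ θ ^ 2 / 64 := by
    calc θ ^ 3 = θ ^ 2 * θ := by ring
      _ ≤ θ ^ 2 * (1 / 64) := by gcongr
      _ = θ ^ 2 / 64 := by ring
  have hθ4 : θ ^ 4 ≤ θ ^ 2 / 64 := by
    calc θ ^ 4 = θ ^ 2 * (θ * θ) := by ring
      _ ≤ θ ^ 2 * (1 / 64 * 1) := by gcongr; linarith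
      _ = θ ^ 2 / 64 := by ring
  have hcp : ((cplaq L (bavgZ L V₀) z μ ν : 𝔸ˣ) : 𝔸) = ((bavgZ L V₀ z μ : 𝔸ˣ) : 𝔸)
      * ((bavgZ L V₀ (z + (L : ℤ) • e μ) ν : 𝔸ˣ) : 𝔸) * (((bavgZ L V₀ (z + (L : ℤ) • e ν) μ)⁻¹ : 𝔸ˣ) : 𝔸)
      * (((bavgZ L V₀ z ν)⁻¹ : 𝔸ˣ) : 𝔸) := by simp only [cplaq, Units.val_mul]
  rw [hcp]
  rw [hTsum] at hP
  calc _ = ‖(_ - 1 - ∑ r : Fin d → Fin L, ((L : ℝ) ^ d)⁻¹ • asum A (z + offZ L r) (rectWord L L μ ν))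
          + ∑ r : Fin d → Fin L, ((L : ℝ) ^ d)⁻¹ • asum A (z + offZ L r) (rectWord L L μ ν)‖ := by
          rw [sub_add_cancel]
    _ ≤ _ := norm_add_le _ _
    _ ≤ (4 * (50 * θ ^ 2) + (3 * θ) ^ 2 * (6 + 4 * (3 * θ) + (3 * θ) ^ 2))
          + (L : ℝ) ^ 2 * (α₀ + expRem (4 * a)) := add_le_add hP hmain
    _ ≤ (L : ℝ) ^ 2 * α₀ + 258 * θ ^ 2 := by linarith [sq_nonneg θ]

/-! ### Proposition 1 for an arbitrary configuration: reduction to the axial gauge by (45) -/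

variable [NormOneClass 𝔸]

/-- (RECORD TWIN of `B7Prop1Explicit.prop1_explicit` for `bavgZ`; the reduction to the axial gauge uses the condition-free covariance `BlockAveragingZdCovariance.bavgZ_gaugeAct_units`.) **Proposition 1 (51) for the record average, kernel-checked with explicit constants.**  Let `V` be a configuration on `ℤ^d` with
values in `{u : |u| ≤ 1, |u⁻¹| ≤ 1}` satisfying (44) `|V(∂p) − 1| ≤ α₀` for all unit plaquettes, and let
`512(d+1)(d+4)L²α₀ ≤ 1`.  Then the average (42) satisfies, for every plaquette `p′` of the `L`-lattice,
`|V̄(∂p′) − 1| ≤ L²α₀ + 258·(8(d+1)(d+4))²·(L²α₀)²` — i.e. (51) with `C₀(d) = 16512(d+1)²(d+4)²`,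
`c₂′(d, L) = 1/(512(d+1)(d+4)L²)`.  Proof = the printed one (pp. 24–26): (45) to pass to the axial gauge of
B5 (1.7) at `y`, the bond bound of p. 24, (47)–(50). [cite: Balaban1985Averaging, Prop. 1 (51) p.26] -/
theorem prop1_explicitZ (L : ℕ) (hL : 1 ≤ L) (z : SiteZ d) {μ ν : Fin d} (hμν : μ ≠ ν)
    (V : SiteZ d → Fin d → 𝔸ˣ) (hV : ∀ x κ, V x κ ∈ U1 𝔸) {α₀ : ℝ} (hα₀ : 0 ≤ α₀)
    (hsmall : 512 * (d + 1) * (d + 4) * (L : ℝ) ^ 2 * α₀ ≤ 1)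
    (h44 : ∀ (x : SiteZ d) (κ κ' : Fin d), κ ≠ κ' → ‖((hol V x (plaqWord κ κ') : 𝔸ˣ) : 𝔸) - 1‖ ≤ α₀) :
    ‖((cplaq L (bavgZ L V) z μ ν : 𝔸ˣ) : 𝔸) - 1‖
      ≤ (L : ℝ) ^ 2 * α₀ + 258 * (8 * (d + 1) * (d + 4) * (L : ℝ) ^ 2 * α₀) ^ 2 := by
  set y : SiteZ d := z + (L : ℤ) • e μ + (L : ℤ) • e ν with hy
  set u : SiteZ d → 𝔸ˣ := axialFn V y with hu
  set V₀ : SiteZ d → Fin d → 𝔸ˣ := gaugeAct u V with hV₀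
  have huU : ∀ x, u x ∈ U1 𝔸 := fun x => axialFn_mem hV y x
  have h44₀ : ∀ x, ‖((hol V₀ x (plaqWord μ ν) : 𝔸ˣ) : 𝔸) - 1‖ ≤ α₀ := fun x => by
    rw [hV₀, hol_gaugeAct_closed _ _ _ _ (disp_plaqWord μ ν), Units.val_mul, Units.val_mul]
    exact (norm_units_conj_sub_one_le (huU x) _).trans (h44 x μ ν hμν)
  have hbond : ∀ x κ, l1 (x - y) ≤ (2 * d + 4) * L + 4 → ‖((V₀ x κ : 𝔸ˣ) : 𝔸) - 1‖ ≤ l1 (x - y) * α₀ :=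
    fun x κ _ => axial_bond_bound V hV y h44 hα₀ x κ
  obtain ⟨hcore, -⟩ := prop1_coreZ L hL z y hy V₀ hα₀ hsmall h44₀ hbond
  -- (45): `V̄₀_c = u(c₋) V̄_c u(c₊)⁻¹` on the four sides, hence `V̄₀(∂p′) = u(z) V̄(∂p′) u(z)⁻¹`
  have hcov : ∀ q κ, bavgZ L V₀ q κ = u q * bavgZ L V q κ * (u (q + (L : ℤ) • e κ))⁻¹ := fun q κ => by
    rw [hV₀]; exact bavgZ_gaugeAct_units L u V q κ
  have hconj := cplaq_conj L u (bavgZ L V) (bavgZ L V₀) z μ ν (hcov z μ) (hcov _ ν) (hcov _ μ) (hcov z ν)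
  refine (norm_sub_one_le_of_conj (X := cplaq L (bavgZ L V) z μ ν) (huU z)).trans ?_
  rw [← hconj]
  exact hcore

end Prop1

end Literature.MathematicalPhysics.QuantumFieldTheory.Balaban1983to89.B7Prop1Rec
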